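import Summits.BirchSwinnertonDyer.BirchSwinnertonDyer.Theorems.ByReductionTypeAtTwoRankOneAtTwoBigImageOddLocalOneDoorPairParity
import Summits.BirchSwinnertonDyer.BirchSwinnertonDyer.Theorems.ByReductionTypeAtTwoRankOneAtTwoBigImageOddLocalOneDoorHalvesBookkeeping
import Summits.BirchSwinnertonDyer.BirchSwinnertonDyer.Theorems.ByReductionTypeAtTwoRankOneAtTwoBigImageOddLocalOneDoorIndexLawOfKolyvaginExact
import Literature.NumberTheory.EllipticCurves.CasselsTateParity
import Literature.NumberTheory.EllipticCurves.BSDQuadraticDescent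
import Literature.NumberTheory.EllipticCurves.SecondDescentShaExponentProofs
import Summits.BirchSwinnertonDyer.Uniform.U2.TransportA
import HarnessLib

/-!
# Route ByReductionTypeAtTwo, crux `RankOneAtTwoBigImageOddLocal` (stmt-BirchSwinnertonDyer-23715), LINE v8.8 `one_door_analytic`:
# the PARITY LEAF `heven` of the bottom rung — `dim Sel₂(Wd/ℚ)` is even at a door datum (Cassels–Tate)

Width prover seat `bsd-line-fkl-p2` g10 (2026-08-28), `--supports stmt-BirchSwinnertonDyer-23715` (helper).  THEOREMS ONLY; no
definition, no `sorry`; the Cassels–Tate pairing enters as the explicit hypothesis `(hCT : exists_casselsTate_pairing)` (the tree's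
named fact bsd.S18, taken exactly as `CasselsTateParity` takes it).  BSD is not proved by any of this.

The lead's kernel engine of Kolyvagin's first `2`-descent over `ℚ` (`Theorems/…OneDoorFirstDescentAtTwo.lean`, p637958) proves
`Sel₂(E^K/ℚ) = 0` (`twinSel_eq_bot`) from, among other leaves, the PARITY input

    heven : ∀ s ∈ Sel', s ≠ 0 → ∃ t ∈ Sel', t ≠ 0 ∧ t ≠ s

— «a non-zero class of `Sel₂(E^K/ℚ)` is never alone», i.e. `dim_𝔽₂ Sel₂(E^K/ℚ)` is even (lead report G11 §2, bullet `heven`: `E′(ℚ)` finite of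
odd order, so `Sel₂(E′/ℚ) = Ш(E′/ℚ)[2]`, whose dimension is even by Cassels–Tate).  This file discharges that leaf in TREE currency at
every door datum of the slice:

* §1 `exists_mem_ne_of_isSquare_card` — a subgroup of SQUARE order containing a non-zero element contains a second one (fact-free);
* §2 `isSquare_card_shaTorsionBy_two_of_casselsTate` — `#Ш(E/K)[2]` is a square when `Ш(E/K)` is finite, from the tree theorem
  `exists_natCard_modN_primaryComponent_sha` (`#(Ш[2^∞]/2) = 2^{2k}`, `CasselsTateParity`) and `#A[2] = #(A/2A)` for the finite group
  `A = Ш[2^∞]` (`Literature.GroupTheory.FiniteAbelian.natCard_torsionBy_eq_natCard_modN`);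
* §3 `isSquare_card_selmerGroup_two_of_rank_zero` / `exists_mem_selmerGroup_two_ne_of_rank_zero` — rank `0`, no rational `2`-torsion,
  `Ш` finite: `#Sel₂(E/ℚ) = #Ш(E/ℚ)[2]` (descent count, Silverman X.4.2) is a square, hence `heven` for `Sel₂(E/ℚ)`;
* §4 `twin_selmerTwo_even_at` — at a door datum of the slice (`W` odd torsion, analytic rank `1`, `rank W(ℚ) = 1`; `K` door-admissible with
  `L(W^{(d_K)},1) ≠ 0`; Gross–Zagier / Kolyvagin at `(N_W, W, K)`; modularity): `rank Wd(ℚ) = 0`, `Wd(ℚ)[2] = 0`, `Ш(Wd/ℚ)` finite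
  (Kolyvagin over `K` + `shaFinite_quadraticTwist_of_shaFinite_baseChange`), so **`heven` holds for `Sel₂(Wd/ℚ)`** — the engine's parity
  input, modulo Cassels–Tate.  (The property is invariant under the transport `H¹(ℚ, Wd[2]) ≅ H¹(ℚ, W[2])` used by the instantiation.)

References: [Cassels1962ArithmeticIV] Thm. 1.1; [SilvermanAEC2009] Thm. X.4.2, X.4.14; [GrossLMS1991] §10; [MazurRubin2010] Lemma 2.10.
-/

set_option autoImplicit false
-- the Theorems namespace of this sub repeats the summit name by design (D-0017 nested layout)
set_option linter.dupNamespace false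

noncomputable section

open scoped Classical AddSubgroup

namespace Summit.BirchSwinnertonDyer.BirchSwinnertonDyer.Theorems.RankOneAtTwoOneDoor

open WeierstrassCurve NumberField Literature.NumberTheory.EllipticCurves Literature.NumberTheory.EllipticCurves.ModularForms
  Literature.NumberTheory.EllipticCurves.KrizLi2019
  Literature.GroupTheory.FiniteAbelian
  Summit.BirchSwinnertonDyer.Rank1Residual
  Summit.BirchSwinnertonDyer.Rank1Residual.F1Sign2
  Summit.BirchSwinnertonDyer.Rank1Residual.F1Sign2.TranspositionDoor
  Summit.BirchSwinnertonDyer.BirchSwinnertonDyer.Theses.ByReductionTypeAtTwo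

/-! ### §1 A subgroup of square order with a non-zero element has a second one -/

/-- **Fact-free**: if `#S` is a perfect square and `s ∈ S` is non-zero, there is `t ∈ S` with `t ∉ {0, s}`.  (Otherwise `S = {0, s}` has
order `2`, not a square; an infinite `S` has `Nat.card S = 0` and the conclusion holds trivially too — but the proof only needs the
cardinality count.) [folklore] -/
theorem exists_mem_ne_of_isSquare_card {V : Type*} [AddCommGroup V] (S : AddSubgroup V) (hsq : IsSquare (Nat.card S))
    {s : V} (hs : s ∈ S) (h0 : s ≠ 0) : ∃ t ∈ S, t ≠ 0 ∧ t ≠ s := by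
  by_contra hcon
  push Not at hcon
  have hset : (S : Set V) = {0, s} := by
    ext t
    simp only [SetLike.mem_coe, Set.mem_insert_iff, Set.mem_singleton_iff]
    refine ⟨fun ht => ?_, ?_⟩
    · by_cases ht0 : t = 0
      · exact Or.inl ht0
      · exact Or.inr (hcon t ht ht0)
    · rintro (rfl | rfl)
      · exact S.zero_mem
      · exact hs
  have hcard : Nat.card S = 2 := by
    rw [← SetLike.coe_sort_coe, hset, Nat.card_coe_set_eq, Set.ncard_pair (fun h => h0 h.symm)]
  rw [hcard] at hsq
  obtain ⟨k, hk⟩ := hsq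
  rcases Nat.lt_or_ge k 2 with hk2 | hk2
  · interval_cases k <;> omega
  · nlinarith

/-! ### §2 Cassels–Tate: `#Ш(E/K)[2]` is a square for finite `Ш` -/

/-- `Ш[2] ≃ (Ш[2^∞])[2]` as sets of elements: the `2`-torsion of `Ш` is the `2`-torsion of its `2`-primary part. [folklore] -/
theorem card_shaTorsionBy_eq_card_torsionBy_primaryComponent {K : Type} [Field K] [NumberField K] (W : WeierstrassCurve K) (p : ℕ) :
    Nat.card (W.sha[(p : ℤ)]) = Nat.card ((↥(AddCommGroup.primaryComponent W.sha p))[(p : ℤ)]) := by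
  refine Nat.card_congr
    { toFun := fun x => ⟨⟨x.1, (AddCommGroup.mem_primaryComponent).mpr ⟨1, by
          rw [pow_one]; exact AddSubgroup.torsionBy.nsmul_iff.mp x.2⟩⟩,
        AddSubgroup.torsionBy.nsmul_iff.mpr (Subtype.ext (by
          rw [AddSubgroupClass.coe_nsmul, ZeroMemClass.coe_zero]; exact AddSubgroup.torsionBy.nsmul_iff.mp x.2))⟩
      invFun := fun y => ⟨(y.1 : W.sha), AddSubgroup.torsionBy.nsmul_iff.mpr (by
          have h := AddSubgroup.torsionBy.nsmul_iff.mp y.2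
          rw [← AddSubgroupClass.coe_nsmul, h, ZeroMemClass.coe_zero])⟩
      left_inv := fun x => by ext; rfl
      right_inv := fun y => by ext; rfl }

/-- **`#Ш(E/K)[2]` is a perfect square** for an elliptic curve over a number field with FINITE `Ш`, granting the Cassels–Tate pairing
(`hCT`): `#(Ш[2^∞]/2·Ш[2^∞]) = 2^{2k}` (tree theorem `exists_natCard_modN_primaryComponent_sha`, `CasselsTateParity`) and
`#A[2] = #(A/2A)` for the finite abelian group `A = Ш[2^∞]` (`natCard_torsionBy_eq_natCard_modN`). [cite: Cassels1962ArithmeticIV, Thm. 1.1]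
[cite: SilvermanAEC2009, Thm. X.4.14] -/
theorem isSquare_card_shaTorsionBy_two_of_casselsTate {K : Type} [Field K] [NumberField K] (W : WeierstrassCurve K) [W.IsElliptic]
    (hCT : exists_casselsTate_pairing (K := K)) [Finite W.sha] : IsSquare (Nat.card (W.sha[(2 : ℤ)])) := by
  haveI : Fact (Nat.Prime 2) := ⟨Nat.prime_two⟩
  obtain ⟨k, hk⟩ := exists_natCard_modN_primaryComponent_sha W 2 hCT
  haveI : Finite ↥(AddCommGroup.primaryComponent W.sha 2) := Finite.of_injective _ Subtype.val_injective
  refine ⟨2 ^ k, ?_⟩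
  have h1 := card_shaTorsionBy_eq_card_torsionBy_primaryComponent W 2
  have h2 := natCard_torsionBy_eq_natCard_modN (T := ↥(AddCommGroup.primaryComponent W.sha 2)) 2
  simp only [Nat.cast_ofNat] at h1 h2
  rw [h1, h2, hk, ← pow_add, two_mul]

/-! ### §3 Rank `0`, no rational `2`-torsion: `#Sel₂(E/ℚ) = #Ш(E/ℚ)[2]` is a square, so `dim Sel₂` is even -/

/-- **`#Sel₂(E/ℚ)` is a perfect square** for `E/ℚ` of Mordell–Weil rank `0` with `E(ℚ)[2] = 0` and finite `Ш`, granting Cassels–Tate: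
the descent count `2^{rk}·#E(ℚ)[2]·#Ш[2] = #Sel₂` (Silverman X.4.2, tree theorem) reads `#Sel₂ = #Ш[2]`, a square by §2.
[cite: SilvermanAEC2009, Thm. X.4.2] [cite: Cassels1962ArithmeticIV, Thm. 1.1] -/
theorem isSquare_card_selmerGroup_two_of_rank_zero (hCT : exists_casselsTate_pairing (K := ℚ))
    (W : WeierstrassCurve ℚ) [W.IsElliptic] [Finite W.sha] (hrk : W.mordellWeilRank = 0)
    (h2 : ∀ T : W.toAffine.Point, 2 • T = 0 → T = 0) : IsSquare (Nat.card (W.selmerGroup 2)) := by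
  have hbot : W.toAffine.Point[(2 : ℤ)] = ⊥ := Summit.BirchSwinnertonDyer.Uniform.U2.torsionBy_two_eq_bot_iff.mpr h2
  have hpt : Nat.card ↥(W.toAffine.Point[(2 : ℤ)]) = 1 := by rw [hbot]; exact AddSubgroup.card_bot
  have hcount := W.pow_mordellWeilRank_mul_natCard_torsionBy_mul_natCard_shaTorsionBy_eq (n := 2) two_ne_zero
  simp only [Nat.cast_ofNat] at hcount
  rw [hrk, pow_zero] at hcount
  -- bridge the point-group instances (the `DecidableEq` on `E(ℚ)` is a subsingleton)
  have hcount' : Nat.card (W.sha[(2 : ℤ)]) = Nat.card (W.selmerGroup 2) := by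
    have h1 : 1 * 1 * Nat.card (W.sha[(2 : ℤ)]) = Nat.card (W.selmerGroup 2) := by
      convert hcount using 3
      convert hpt.symm using 10
    simpa using h1
  rw [← hcount']
  exact isSquare_card_shaTorsionBy_two_of_casselsTate W hCT

/-- **`heven` for `Sel₂(E/ℚ)`** (rank `0`, `E(ℚ)[2] = 0`, `Ш` finite, Cassels–Tate): a non-zero `2`-Selmer class is never alone — the
parity input of `eq_zero_of_mem_twinSel` / `twinSel_eq_bot` (`…OneDoorFirstDescentAtTwo.lean`) in tree currency.
[cite: Cassels1962ArithmeticIV, Thm. 1.1] [cite: GrossLMS1991, §10] -/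
theorem exists_mem_selmerGroup_two_ne_of_rank_zero (hCT : exists_casselsTate_pairing (K := ℚ))
    (W : WeierstrassCurve ℚ) [W.IsElliptic] [Finite W.sha] (hrk : W.mordellWeilRank = 0)
    (h2 : ∀ T : W.toAffine.Point, 2 • T = 0 → T = 0)
    {s : W.galH1Torsion 2} (hs : s ∈ W.selmerGroup 2) (h0 : s ≠ 0) : ∃ t ∈ W.selmerGroup 2, t ≠ 0 ∧ t ≠ s :=
  exists_mem_ne_of_isSquare_card (W.selmerGroup 2) (isSquare_card_selmerGroup_two_of_rank_zero hCT W hrk h2) hs h0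

/-! ### §4 The parity leaf at a door datum of the slice -/

/-- **`Ш(Wd/ℚ)` is finite at a door datum**, from Gross–Zagier and Kolyvagin at `(N_W, W, K)` (`Ш(E/K)` finite, `P` non-torsion since
`L'(E/K,1) = L'(W,1)·L(W^{(d_K)},1) ≠ 0`) and the descent of finiteness to the twist (`shaFinite_quadraticTwist_of_shaFinite_baseChange`,
`d_K = c·q²`, invariance under variable changes). [cite: Darmon2004, §3.9] [cite: GrossZagier1986, Thm. I.6.3] -/
theorem finite_sha_twin_at (hmod : hasEntireLFunction_rat)
    (W : WeierstrassCurve ℚ) [W.IsElliptic] [W.IsGloballyMinimal] [NeZero (W.conductorNorm ℤ)] (hr : W.analyticRank = 1)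
    (K : Type) [Field K] [NumberField K] (hK : IsImaginaryQuadratic K)
    (hGZ : gross_zagier (W.conductorNorm ℤ) W K) (hKo : kolyvagin (W.conductorNorm ℤ) W K)
    (hadm : DoorAdmissible W (NumberField.discr K))
    (hLt : (W.quadraticTwist (NumberField.discr K : ℚ)).entireLFunction 1 ≠ 0)
    (Dt : ModularParametrizationData W (W.conductorNorm ℤ))
    (H : HeegnerDatum (W.conductorNorm ℤ) (NumberField.discr K)) (ι : K →+* ℂ)
    (P : (W.baseChange K).toAffine.Point)
    (hP : WeierstrassCurve.Affine.Point.map ι.toRatAlgHom P = heegnerPointComplex Dt H)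
    (Wd : WeierstrassCurve ℚ) [Wd.IsElliptic] (Cd : VariableChange ℚ)
    (hWd : Cd • W.quadraticTwist (NumberField.discr K : ℚ) = Wd) : Finite Wd.sha := by
  haveI hEK : (W.baseChange K).IsElliptic := isElliptic_baseChange' W K
  have h2K : Module.finrank ℚ K = 2 := hK.1
  have hHN : SatisfiesHeegnerHypothesis (W.conductorNorm ℤ) K := satisfiesHeegnerHypothesis_of_doorAdmissible W K hK hadm
  have hL0 : W.entireLFunction 1 = 0 := entireLFunction_one_eq_zero_of_analyticRank_eq_one hr
  obtain ⟨-, hderiv⟩ := leadingLCoeff_eq_deriv_of_analyticRank_eq_one hr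
  have hprod := lDerivEK_eq_deriv_mul W K hmod hL0
  have hLK : LDerivEK W K ≠ 0 := by rw [hprod]; exact mul_ne_zero hderiv hLt
  have hPH : IsHeegnerPoint (W.conductorNorm ℤ) W K P := ⟨Dt, H, ι, hP⟩
  have hPinf : ¬ IsOfFinAddOrder P :=
    (lDerivEK_ne_zero_iff_not_isOfFinAddOrder W (W.conductorNorm ℤ) K hGZ hK hHN hPH).mp hLK
  obtain ⟨-, hShaK⟩ := hKo hK hHN hPH hPinf
  -- descend finiteness to the twist by `c`, then transport to `d_K = c·q²` and to the model `Wd`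
  obtain ⟨θ, c, hθ, hc⟩ := Literature.NumberTheory.QuadraticFields.Quadratic.exists_sq_eq_algebraMap (F := ℚ) (K := K) h2K
  have hfc : (W.quadraticTwist c).ShaFinite := shaFinite_quadraticTwist_of_shaFinite_baseChange W K hθ hc hShaK
  obtain ⟨q, hq, hd⟩ := NumberField.exists_discr_eq_mul_sq h2K hθ hc
  obtain ⟨C₁, hC₁⟩ := W.exists_variableChange_quadraticTwist_mul_sq c q hq
  rw [← hd] at hC₁
  have hc0 : c ≠ 0 := by
    rintro rfl
    apply Literature.NumberTheory.QuadraticFields.Quadratic.ne_zero_of_not_mem_range hθ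
    have : θ ^ 2 = 0 := by rw [hc, map_zero]
    exact pow_eq_zero_iff (n := 2) (by norm_num) |>.mp this
  haveI : (W.quadraticTwist c).IsElliptic := W.isElliptic_quadraticTwist hc0
  have hfd : (W.quadraticTwist (NumberField.discr K : ℚ)).ShaFinite := by
    rw [← hC₁]; exact (shaFinite_variableChange_iff_holds (W.quadraticTwist c) C₁).mpr hfc
  have hD0 : (NumberField.discr K : ℚ) ≠ 0 := by exact_mod_cast NumberField.discr_ne_zero K
  haveI hEt : (W.quadraticTwist (NumberField.discr K : ℚ)).IsElliptic := W.isElliptic_quadraticTwist hD0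
  have hfWd : Wd.ShaFinite := by
    rw [← hWd]; exact (shaFinite_variableChange_iff_holds (W.quadraticTwist (NumberField.discr K : ℚ)) Cd).mpr hfd
  exact hfWd

/-- **THE PARITY LEAF `heven` AT A DOOR DATUM (tree currency).**  `W/ℚ` globally minimal with odd torsion order, analytic rank `1` and
`rank W(ℚ) = 1`; `K` imaginary quadratic, `d_K` door-admissible, `L(W^{(d_K)},1) ≠ 0`; Gross–Zagier / Kolyvagin at `(N_W, W, K)`, modularity
(`hnf`); `Dt`, `H`, `ι`, the point `P` over the complex Heegner point; `Wd` a model of `W^{(d_K)}`; and the Cassels–Tate pairing (`hCT`, named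
fact).  THEN every non-zero class of `Sel₂(Wd/ℚ)` has a companion `t ∉ {0, s}` in `Sel₂(Wd/ℚ)` — i.e. `dim_𝔽₂ Sel₂(Wd/ℚ)` is even: `rank Wd(ℚ) = 0`
(`rank E(K) = 1 = rank W(ℚ) + rank Wd(ℚ)`), `Wd(ℚ)[2] = 0` (odd torsion + twist invariance), `Ш(Wd/ℚ)` finite (§4), so `#Sel₂(Wd/ℚ) = #Ш(Wd/ℚ)[2]`
is a square (§§2–3).  This is the hypothesis `heven` of `twinSel_eq_bot` (`…OneDoorFirstDescentAtTwo.lean`) at the datum, modulo PRINT.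
[cite: Cassels1962ArithmeticIV, Thm. 1.1] [cite: GrossLMS1991, §10] [cite: MazurRubin2010, Lemma 2.10] -/
theorem twin_selmerTwo_even_at (hCT : exists_casselsTate_pairing (K := ℚ)) (hnf : exists_isNewformOf)
    (W : WeierstrassCurve ℚ) [W.IsElliptic] [W.IsGloballyMinimal] [NeZero (W.conductorNorm ℤ)]
    (hT : Odd W.torsionOrder) (hr : W.analyticRank = 1) (hrQ : W.mordellWeilRank = 1)
    (K : Type) [Field K] [NumberField K] (hK : IsImaginaryQuadratic K)
    (hGZ : gross_zagier (W.conductorNorm ℤ) W K) (hKo : kolyvagin (W.conductorNorm ℤ) W K)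
    (hadm : DoorAdmissible W (NumberField.discr K))
    (hLt : (W.quadraticTwist (NumberField.discr K : ℚ)).entireLFunction 1 ≠ 0)
    (Dt : ModularParametrizationData W (W.conductorNorm ℤ))
    (H : HeegnerDatum (W.conductorNorm ℤ) (NumberField.discr K)) (ι : K →+* ℂ)
    (P : (W.baseChange K).toAffine.Point)
    (hP : WeierstrassCurve.Affine.Point.map ι.toRatAlgHom P = heegnerPointComplex Dt H)
    (Wd : WeierstrassCurve ℚ) [Wd.IsElliptic] (Cd : VariableChange ℚ)
    (hWd : Cd • W.quadraticTwist (NumberField.discr K : ℚ) = Wd)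
    {s : Wd.galH1Torsion 2} (hs : s ∈ Wd.selmerGroup 2) (h0 : s ≠ 0) : ∃ t ∈ Wd.selmerGroup 2, t ≠ 0 ∧ t ≠ s := by
  have hmod : hasEntireLFunction_rat := hasEntireLFunction_rat_of_exists_isNewformOf hnf
  have h2K : Module.finrank ℚ K = 2 := hK.1
  have hD0 : (NumberField.discr K : ℚ) ≠ 0 := by exact_mod_cast NumberField.discr_ne_zero K
  -- rank `Wd(ℚ) = 0`
  obtain ⟨hrkK, -, -, -⟩ := exists_unique_exponent_at_door hmod W hr K hK hGZ hKo hadm hLt Dt H ι P hP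
  have hrkd : Wd.mordellWeilRank = 0 := mordellWeilRank_twin_eq_zero W K h2K hrkK hrQ Wd Cd hWd
  -- no rational `2`-torsion on the twin
  have hW2 : ∀ T : W.toAffine.Point, 2 • T = 0 → T = 0 :=
    EggDoubling.eq_zero_of_two_smul_eq_zero W (noRationalTwoTorsion_of_odd_torsionOrder W hT)
  have hbotW : W.toAffine.Point[(2 : ℤ)] = ⊥ := Summit.BirchSwinnertonDyer.Uniform.U2.torsionBy_two_eq_bot_iff.mpr hW2
  have hbotWd := Summit.BirchSwinnertonDyer.Uniform.U2.torsionBy_two_eq_bot_of_twist W hD0 Wd ⟨Cd⁻¹, by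
    rw [← hWd, inv_smul_smul]⟩ hbotW
  have hWd2 : ∀ T : Wd.toAffine.Point, 2 • T = 0 → T = 0 :=
    Summit.BirchSwinnertonDyer.Uniform.U2.torsionBy_two_eq_bot_iff.mp hbotWd
  -- `Ш(Wd/ℚ)` finite
  haveI : Finite Wd.sha := finite_sha_twin_at hmod W hr K hK hGZ hKo hadm hLt Dt H ι P hP Wd Cd hWd
  exact exists_mem_selmerGroup_two_ne_of_rank_zero hCT Wd hrkd hWd2 hs h0

end Summit.BirchSwinnertonDyer.BirchSwinnertonDyer.Theorems.RankOneAtTwoOneDoor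

end
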